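import Literature.MathematicalPhysics.QuantumFieldTheory.Balaban1983to89.B14Eq218Concrete

/-!
# `Balaban1983to89.B14Eq218SeqSucc` — CMP 119 [Balaban1988Convergent] (2.1) p. 254, (2.18) p. 257, §3 p. 267 / p. 270:
# the summation index of (2.18) ONE STEP UP — an admissible sequence of length `k + 1` IS an admissible sequence of
# length `k` together with ONE new admissible pair `(Ω_{k+1}, Λ_{k+1})`; `init` / `snoc` / `extOf`, the equivalence
# `Seq D (k+1) ≃ Σ s : Seq D k, ExtPair D k s`, the splitting of the sum `Σ_{s'} = Σ_s Σ_e`, and the base `k = 0`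

statement-level skeleton of published theorems with citation tags; proofs where landed; nothing here is a claim
about the Yang–Mills mass gap.

CITATION HEADER (lean-in-tree rule).  Source: T. Bałaban, *Convergent renormalization expansions for lattice gauge
theories*, Commun. Math. Phys. **119**, 243–285 (1988), doi:10.1007/bf01217741 [Balaban1988Convergent] (cell paper
B14 = «[III]»; held `paper:balaban1988-cmp119-convergent-renormalization`, journal page = PDF page + 242; p. 267 and
p. 270 read for this file from the text layer `p0025`, `p0028`; (2.1) p. 254 and (2.18) p. 257 as quoted in r11's
`B14Eq218Concrete`).  Cell `pub-ymgap` (HUMAN RULING D-0062, Track A), typed by seat `pub-ymgap-dag-n22-b` as the typing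
hand of the dedicated definer `pub-ymgap-node00-def-T` (its ONLINE word, pub-ymgap INBOX [NODE00-DEF-T-G0-ONLINE] item (5)):
ONE generic, design-independent bookkeeping block next to r11's `B14Eq218Concrete` (imports only it; nothing there modified),
consumed by name in `Node00/TStepOfRecord.lean` / `Node00/RepTowerOfRecord.lean` (the (k+1)-slice of `𝐓ρ_k` is defined
through `init`, and the averaging identity reduces to `Σ_e ζ_e = 1` through `sum_seq_succ`).

THE PRINTED TEXT.  (2.1) p. 254: *«Ω_j ∈ 𝐃_j … Λ_j ∈ 𝐃_j, such that Ω₁ ⊃ Λ₁ ⊃ Ω₂ ⊃ Λ₂ ⊃ … ⊃ Ω_k ⊃ Λ_k»*; (2.18)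
p. 257: *«ρ_k(V_k) = Σ_{{Ω_j},{Λ_j}} χ_k(Ω_k)𝐓_k({Ω_j},{Λ_j}) exp A_k(1/g_k², U_k), where the summation is over the
admissible sequences of domains»*; §3 p. 267 [PDF 25]: *«This way each term in (3.1) has been written as a sum of terms
of the same type, but with the new characteristic functions inserted. We represent this sum as a sum over admissible
domains Ω_{k+1}, and for a fixed Ω_{k+1} we resum over admissible sets P_{k+1}, Q_{k+1} … Denote the sum by
ζ(Ω_{k+1}).»*; p. 270 [PDF 28]: *«We write this sum as a sum over domains Λ_{k+1}, and for a fixed domain Λ_{k+1}, as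
a sum over the admissible sets S_{k+1}.»*  So the index of the (k+1)-th representation is the index of the k-th one
together with the new pair `(Ω_{k+1}, Λ_{k+1})`, `Λ_{k+1} ⊆ Ω_{k+1} ⊆ Λ_k`, both in the class `𝐃_{k+1}` — which is
all this file types.

WHAT THIS FILE PROVIDES (definitions WITH BODY + theorems; no `instance`, no notation; nothing of Bałaban's asserted):
* `Seq.init` (drop the last pair; `init_Ω` / `init_Λ` on the window), `Seq.restrict` (any shorter length; `restrict_self`,
  `restrict_restrict`, `init_eq_restrict`, `restrict_snoc`), `Seq.ExtPair D k s` (an `abbrev` for the SUBTYPE of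
  pairs `(Ω_{k+1}, Λ_{k+1})` admissible after `s` — so `Finite (ExtPair D k s)` is found by instance search from
  `[Finite α]`; a `Fintype` is OFFERED as the `noncomputable def Seq.extPairFintype`, never registered), `Seq.snoc`
  (append a pair; `snoc_Ω_succ` / `snoc_Λ_succ` / `snoc_Ω_of_le` / `snoc_Λ_of_le`), `Seq.extOf` (the last pair of a
  length-(k+1) index), `init_snoc`, `extOf_snoc_val`, `snoc_init_extOf`;
* `Seq.seqSuccEquiv : Seq D (k+1) ≃ Σ s : Seq D k, ExtPair D k s`;
* THE SUM SPLITTING in two lint-clean forms: `Seq.sum_seq_succ` (over the pairs, with the `Fintype` family as an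
  instance BINDER `[∀ s, Fintype (ExtPair D k s)]`, dischargeable by `Seq.extPairFintype`; `sum_seq_succ_init_mul` the form with
  a factor through `init`) and `Seq.sum_seq_succ_fiber` (over the fibres of `init`, `[DecidableEq (Seq D k)]` only; `sum_fiber_eq_sum_extPair`);
* THE BASE `k = 0`: `Seq.zero D` (every index is off-window), `Seq.eq_zero`, `Seq.uniqueZero` (a `def`), `Seq.sum_seq_zero`.

HONEST FRAMING: count-neutral Track-A bookkeeping (definitions of record for the W00 ₇b/₉ «T-step + represented tower»
lane); nothing of Bałaban's estimates asserted or assumed; one finite 𝕋⁴ programme at fixed ε, Bałaban AS PRINTED with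
locators; nothing continuum / ℝ⁴ / OS / mass-gap / Clay.

## References
* [Balaban1988Convergent] T. Bałaban, Commun. Math. Phys. 119 (1988) 243–285: (2.1) p. 254, (2.18) p. 257, §3 p. 267,
  (3.23)–(3.25) pp. 269–270.
-/

open Set
open scoped BigOperators

namespace Literature.MathematicalPhysics.QuantumFieldTheory.Balaban1983to89.B14.Eq218Concrete

open Literature.MathematicalPhysics.QuantumFieldTheory.Balaban1983to89

noncomputable section

namespace Seq

variable {α : Type*} {D : ℕ → Set (Set α)} {k : ℕ}

/-! ## §1  `init`: an index of length `k + 1` restricted to its first `k` pairs -/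

/-- **THE FIRST `k` PAIRS** of an admissible sequence of length `k + 1`: `(Ω₁,…,Ω_k; Λ₁,…,Λ_k)` (the (2.1)-chain
restricted to the top index `k`, normalised off the window). [cite: Balaban1988Convergent, (2.1) p.254, (2.18) p.257] -/
def init (s : Seq D (k + 1)) : Seq D k :=
  ofChain s.Ω s.Λ (s.chain.mono_k (Nat.le_succ k))

/-- On the window `1 ≤ j ≤ k`, `init` keeps `Ω_j`. [cite: Balaban1988Convergent, (2.1) p.254] -/
@[simp] theorem init_Ω (s : Seq D (k + 1)) {j : ℕ} (h1 : 1 ≤ j) (hj : j ≤ k) : s.init.Ω j = s.Ω j := by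
  simp [init, h1, hj]

/-- On the window `1 ≤ j ≤ k`, `init` keeps `Λ_j`. [cite: Balaban1988Convergent, (2.1) p.254] -/
@[simp] theorem init_Λ (s : Seq D (k + 1)) {j : ℕ} (h1 : 1 ≤ j) (hj : j ≤ k) : s.init.Λ j = s.Λ j := by
  simp [init, h1, hj]

/-- **RESTRICTION TO ANY SHORTER LENGTH** `k' ≤ k`: the first `k'` pairs (the (2.1)-chain restricted to the top index
`k'`, normalised off the window); `init` is the case `k' = k - 1`. [cite: Balaban1988Convergent, (2.1) p.254, (2.18) p.257] -/
def restrict {k' : ℕ} (hk : k' ≤ k) (s : Seq D k) : Seq D k' :=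
  ofChain s.Ω s.Λ (s.chain.mono_k hk)

/-- On the window `1 ≤ j ≤ k'`, `restrict` keeps `Ω_j`. [cite: Balaban1988Convergent, (2.1) p.254] -/
@[simp] theorem restrict_Ω {k' : ℕ} (hk : k' ≤ k) (s : Seq D k) {j : ℕ} (h1 : 1 ≤ j) (hj : j ≤ k') :
    (s.restrict hk).Ω j = s.Ω j := by
  simp [restrict, h1, hj]

/-- On the window `1 ≤ j ≤ k'`, `restrict` keeps `Λ_j`. [cite: Balaban1988Convergent, (2.1) p.254] -/
@[simp] theorem restrict_Λ {k' : ℕ} (hk : k' ≤ k) (s : Seq D k) {j : ℕ} (h1 : 1 ≤ j) (hj : j ≤ k') :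
    (s.restrict hk).Λ j = s.Λ j := by
  simp [restrict, h1, hj]

/-- `init` is the restriction to length `k`. [cite: Balaban1988Convergent, (2.1) p.254] -/
theorem init_eq_restrict (s : Seq D (k + 1)) : s.init = s.restrict (Nat.le_succ k) := rfl

/-- Restriction to the full length is the identity. [cite: Balaban1988Convergent, (2.1) p.254] -/
@[simp] theorem restrict_self (s : Seq D k) : s.restrict le_rfl = s := by
  apply ext'
  · funext j
    by_cases hj : 1 ≤ j ∧ j ≤ k
    · rw [restrict_Ω _ _ hj.1 hj.2]
    · rw [s.Ω_off j hj, (s.restrict le_rfl).Ω_off j hj]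
  · funext j
    by_cases hj : 1 ≤ j ∧ j ≤ k
    · rw [restrict_Λ _ _ hj.1 hj.2]
    · rw [s.Λ_off j hj, (s.restrict le_rfl).Λ_off j hj]

/-- Restrictions compose. [cite: Balaban1988Convergent, (2.1) p.254] -/
theorem restrict_restrict {k' k'' : ℕ} (hk : k' ≤ k) (hk' : k'' ≤ k') (s : Seq D k) :
    (s.restrict hk).restrict hk' = s.restrict (hk'.trans hk) := by
  apply ext'
  · funext j
    by_cases hj : 1 ≤ j ∧ j ≤ k''
    · rw [restrict_Ω _ _ hj.1 hj.2, restrict_Ω _ _ hj.1 (hj.2.trans hk'), restrict_Ω _ _ hj.1 hj.2]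
    · rw [((s.restrict hk).restrict hk').Ω_off j hj, (s.restrict (hk'.trans hk)).Ω_off j hj]
  · funext j
    by_cases hj : 1 ≤ j ∧ j ≤ k''
    · rw [restrict_Λ _ _ hj.1 hj.2, restrict_Λ _ _ hj.1 (hj.2.trans hk'), restrict_Λ _ _ hj.1 hj.2]
    · rw [((s.restrict hk).restrict hk').Λ_off j hj, (s.restrict (hk'.trans hk)).Λ_off j hj]

/-! ## §2  `ExtPair`: the new admissible pair `(Ω_{k+1}, Λ_{k+1})` after an index of length `k` -/

/-- **THE NEW ADMISSIBLE PAIR** `(Ω_{k+1}, Λ_{k+1})` after the admissible sequence `s` of length `k` (p. 267: *«a sum over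
admissible domains Ω_{k+1}»*, p. 270: *«a sum over domains Λ_{k+1}»*): both in the class `𝐃_{k+1}`, `Λ_{k+1} ⊆ Ω_{k+1}`,
and — when `k ≥ 1` — `Ω_{k+1} ⊆ Λ_k` (the chain condition of (2.1)).  An `abbrev` for a subtype of `Set α × Set α`
(so finiteness is inherited from `[Finite α]` by instance search; no instance is declared here).
[cite: Balaban1988Convergent, (2.1) p.254, §3 p.267, p.270] -/
abbrev ExtPair (D : ℕ → Set (Set α)) (k : ℕ) (s : Seq D k) : Type _ :=
  {p : Set α × Set α // p.1 ∈ D (k + 1) ∧ p.2 ∈ D (k + 1) ∧ p.2 ⊆ p.1 ∧ (1 ≤ k → p.1 ⊆ s.Λ k)}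

/-- On a finite lattice the new admissible pairs form a finite type (inherited from `Set α × Set α`).
[cite: Balaban1988Convergent, (2.18) p.257, §3 p.267] -/
theorem finite_extPair [Finite α] (s : Seq D k) : Finite (ExtPair D k s) := inferInstance

/-- The `Fintype` structure on the new admissible pairs, OFFERED (a `def`, to be bound locally by the consumer — e.g.
as the instance binder of `sum_seq_succ`), not registered. [cite: Balaban1988Convergent, (2.18) p.257, §3 p.267] -/
@[reducible] def extPairFintype [Finite α] (s : Seq D k) : Fintype (ExtPair D k s) := Fintype.ofFinite _

/-- Appending an admissible pair to a (2.1)-chain of length `k` gives a (2.1)-chain of length `k + 1`.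
[cite: Balaban1988Convergent, (2.1) p.254] -/
theorem chain21_snoc (s : Seq D k) (e : ExtPair D k s) :
    Chain21 D (k + 1) (Function.update s.Ω (k + 1) e.1.1) (Function.update s.Λ (k + 1) e.1.2) where
  memΩ j h1 hj := by
    rcases Nat.lt_or_eq_of_le hj with hlt | rfl
    · rw [Function.update_of_ne (by omega)]; exact s.chain.memΩ j h1 (by omega)
    · rw [Function.update_self]; exact e.2.1
  memΛ j h1 hj := by
    rcases Nat.lt_or_eq_of_le hj with hlt | rfl
    · rw [Function.update_of_ne (by omega)]; exact s.chain.memΛ j h1 (by omega)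
    · rw [Function.update_self]; exact e.2.2.1
  Λ_subset j h1 hj := by
    rcases Nat.lt_or_eq_of_le hj with hlt | rfl
    · rw [Function.update_of_ne (by omega), Function.update_of_ne (by omega)]
      exact s.chain.Λ_subset j h1 (by omega)
    · rw [Function.update_self, Function.update_self]; exact e.2.2.2.1
  Ω_succ_subset j h1 hj := by
    rcases Nat.lt_or_eq_of_le (Nat.le_of_lt_succ hj) with hlt | rfl
    · rw [Function.update_of_ne (by omega), Function.update_of_ne (by omega)]
      exact s.chain.Ω_succ_subset j h1 hlt
    · rw [Function.update_self, Function.update_of_ne (by omega)]; exact e.2.2.2.2 h1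

/-! ## §3  `snoc` / `extOf` and the round trips -/

/-- **APPEND THE NEW PAIR**: the admissible sequence `(Ω₁,…,Ω_k,Ω_{k+1}; Λ₁,…,Λ_k,Λ_{k+1})` of length `k + 1`.
[cite: Balaban1988Convergent, (2.1) p.254, §3 p.267, p.270] -/
def snoc (s : Seq D k) (e : ExtPair D k s) : Seq D (k + 1) :=
  ofChain (Function.update s.Ω (k + 1) e.1.1) (Function.update s.Λ (k + 1) e.1.2) (chain21_snoc s e)

/-- The appended index has `Ω_{k+1}` = the new pair's first domain. [cite: Balaban1988Convergent, §3 p.267] -/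
@[simp] theorem snoc_Ω_succ (s : Seq D k) (e : ExtPair D k s) : (s.snoc e).Ω (k + 1) = e.1.1 := by
  simp [snoc]

/-- The appended index has `Λ_{k+1}` = the new pair's second domain. [cite: Balaban1988Convergent, §3 p.270] -/
@[simp] theorem snoc_Λ_succ (s : Seq D k) (e : ExtPair D k s) : (s.snoc e).Λ (k + 1) = e.1.2 := by
  simp [snoc]

/-- Below the new step the appended index keeps `Ω_j`. [cite: Balaban1988Convergent, (2.1) p.254] -/
@[simp] theorem snoc_Ω_of_le (s : Seq D k) (e : ExtPair D k s) {j : ℕ} (h1 : 1 ≤ j) (hj : j ≤ k) :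
    (s.snoc e).Ω j = s.Ω j := by
  rw [snoc, ofChain_Ω _ h1 (Nat.le_succ_of_le hj), Function.update_of_ne (by omega)]

/-- Below the new step the appended index keeps `Λ_j`. [cite: Balaban1988Convergent, (2.1) p.254] -/
@[simp] theorem snoc_Λ_of_le (s : Seq D k) (e : ExtPair D k s) {j : ℕ} (h1 : 1 ≤ j) (hj : j ≤ k) :
    (s.snoc e).Λ j = s.Λ j := by
  rw [snoc, ofChain_Λ _ h1 (Nat.le_succ_of_le hj), Function.update_of_ne (by omega)]

/-- **THE LAST PAIR** `(Ω_{k+1}, Λ_{k+1})` of an admissible sequence of length `k + 1`, admissible after its `init`.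
[cite: Balaban1988Convergent, (2.1) p.254, §3 p.267, p.270] -/
def extOf (s' : Seq D (k + 1)) : ExtPair D k s'.init :=
  ⟨(s'.Ω (k + 1), s'.Λ (k + 1)),
    s'.chain.memΩ (k + 1) (Nat.succ_pos k) le_rfl, s'.chain.memΛ (k + 1) (Nat.succ_pos k) le_rfl,
    s'.chain.Λ_subset (k + 1) (Nat.succ_pos k) le_rfl,
    fun h1 => by rw [init_Λ s' h1 le_rfl]; exact s'.chain.Ω_succ_subset k h1 (Nat.lt_succ_self k)⟩

/-- The last pair's value. [cite: Balaban1988Convergent, §3 p.267, p.270] -/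
@[simp] theorem extOf_val (s' : Seq D (k + 1)) : (s'.extOf).1 = (s'.Ω (k + 1), s'.Λ (k + 1)) := rfl

/-- Dropping the appended pair returns the original index. [cite: Balaban1988Convergent, (2.1) p.254] -/
@[simp] theorem init_snoc (s : Seq D k) (e : ExtPair D k s) : (s.snoc e).init = s := by
  apply ext'
  · funext j
    by_cases hj : 1 ≤ j ∧ j ≤ k
    · rw [init_Ω _ hj.1 hj.2, snoc_Ω_of_le s e hj.1 hj.2]
    · rw [s.Ω_off j hj, (s.snoc e).init.Ω_off j hj]
  · funext j
    by_cases hj : 1 ≤ j ∧ j ≤ k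
    · rw [init_Λ _ hj.1 hj.2, snoc_Λ_of_le s e hj.1 hj.2]
    · rw [s.Λ_off j hj, (s.snoc e).init.Λ_off j hj]

/-- Restricting an appended index to any length `k' ≤ k` forgets the appended pair. [cite: Balaban1988Convergent, (2.1) p.254] -/
theorem restrict_snoc {k' : ℕ} (hk : k' ≤ k) (s : Seq D k) (e : ExtPair D k s) :
    (s.snoc e).restrict (Nat.le_succ_of_le hk) = s.restrict hk := by
  rw [← restrict_restrict (Nat.le_succ k) hk, ← init_eq_restrict, init_snoc]

/-- The last pair of an appended index is the appended pair (as a value in `Set α × Set α`).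
[cite: Balaban1988Convergent, §3 p.267, p.270] -/
@[simp] theorem extOf_snoc_val (s : Seq D k) (e : ExtPair D k s) : ((s.snoc e).extOf).1 = e.1 := by
  rw [extOf_val, snoc_Ω_succ, snoc_Λ_succ]

/-- An index of length `k + 1` is its `init` with its last pair appended. [cite: Balaban1988Convergent, (2.1) p.254, §3 p.267] -/
@[simp] theorem snoc_init_extOf (s' : Seq D (k + 1)) : s'.init.snoc s'.extOf = s' := by
  apply ext'
  · funext j
    by_cases hj : 1 ≤ j ∧ j ≤ k + 1
    · rcases Nat.lt_or_eq_of_le hj.2 with hlt | rfl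
      · rw [snoc_Ω_of_le _ _ hj.1 (Nat.le_of_lt_succ hlt), init_Ω _ hj.1 (Nat.le_of_lt_succ hlt)]
      · rw [snoc_Ω_succ, extOf_val]
    · rw [s'.Ω_off j hj, (s'.init.snoc s'.extOf).Ω_off j hj]
  · funext j
    by_cases hj : 1 ≤ j ∧ j ≤ k + 1
    · rcases Nat.lt_or_eq_of_le hj.2 with hlt | rfl
      · rw [snoc_Λ_of_le _ _ hj.1 (Nat.le_of_lt_succ hlt), init_Λ _ hj.1 (Nat.le_of_lt_succ hlt)]
      · rw [snoc_Λ_succ, extOf_val]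
    · rw [s'.Λ_off j hj, (s'.init.snoc s'.extOf).Λ_off j hj]

/-- The no-large-field index of length `k + 1` restricts to the no-large-field index of length `k`.
[cite: Balaban1988Convergent, (2.1) p.255, (2.18) p.257] -/
theorem init_top (huniv : ∀ j, 1 ≤ j → j ≤ k + 1 → (Set.univ : Set α) ∈ D j) :
    (top D (k + 1) huniv).init = top D k (fun j h1 hj => huniv j h1 (Nat.le_succ_of_le hj)) := by
  apply ext'
  · funext j
    by_cases hj : 1 ≤ j ∧ j ≤ k
    · rw [init_Ω _ hj.1 hj.2]; simp [top, hj.1, hj.2, Nat.le_succ_of_le hj.2]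
    · rw [(top D (k + 1) huniv).init.Ω_off j hj, (top D k _).Ω_off j hj]
  · funext j
    by_cases hj : 1 ≤ j ∧ j ≤ k
    · rw [init_Λ _ hj.1 hj.2]; simp [top, hj.1, hj.2, Nat.le_succ_of_le hj.2]
    · rw [(top D (k + 1) huniv).init.Λ_off j hj, (top D k _).Λ_off j hj]

/-- The last pair of the no-large-field index is `(T_η, T_η)`. [cite: Balaban1988Convergent, (2.1) p.255, (2.18) p.257] -/
theorem extOf_top_val (huniv : ∀ j, 1 ≤ j → j ≤ k + 1 → (Set.univ : Set α) ∈ D j) :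
    ((top D (k + 1) huniv).extOf).1 = (Set.univ, Set.univ) := by
  rw [extOf_val, top_Ω huniv (Nat.succ_pos k), top_Λ huniv (Nat.succ_pos k)]

/-! ## §4  The equivalence and the splitting of the sum (2.18) one step up -/

/-- **AN ADMISSIBLE SEQUENCE OF LENGTH `k + 1` IS AN ADMISSIBLE SEQUENCE OF LENGTH `k` WITH ONE NEW ADMISSIBLE PAIR**:
`Seq D (k+1) ≃ Σ s : Seq D k, ExtPair D k s` (`s' ↦ ⟨s'.init, s'.extOf⟩`, inverse `⟨s, e⟩ ↦ s.snoc e`).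
[cite: Balaban1988Convergent, (2.1) p.254, (2.18) p.257, §3 p.267, p.270] -/
def seqSuccEquiv : Seq D (k + 1) ≃ Σ s : Seq D k, ExtPair D k s where
  toFun s' := ⟨s'.init, s'.extOf⟩
  invFun x := x.1.snoc x.2
  left_inv s' := snoc_init_extOf s'
  right_inv x := by
    obtain ⟨s, e⟩ := x
    exact Sigma.subtype_ext (init_snoc s e) (extOf_snoc_val s e)

/-- **THE SUM OVER ADMISSIBLE SEQUENCES OF LENGTH `k + 1` SPLITS** as the sum over those of length `k` of the sum over the
new admissible pairs: `Σ_{s'} f(s') = Σ_s Σ_e f(s.snoc e)` (p. 267 / p. 270: *«a sum over admissible domains Ω_{k+1} …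
a sum over domains Λ_{k+1}»* inside each old term).  The `Fintype` structures on the pairs are an instance BINDER
(discharge with `Seq.extPairFintype`). [cite: Balaban1988Convergent, (2.18) p.257, §3 p.267, p.270] -/
theorem sum_seq_succ [Finite α] [∀ s : Seq D k, Fintype (ExtPair D k s)] {M : Type*} [AddCommMonoid M]
    (f : Seq D (k + 1) → M) : ∑ s', f s' = ∑ s : Seq D k, ∑ e : ExtPair D k s, f (s.snoc e) := by
  rw [Fintype.sum_equiv seqSuccEquiv f (fun x => f (x.1.snoc x.2)) (fun s' => ?_)]
  · rw [Fintype.sum_sigma]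
  · simp [seqSuccEquiv]

/-- THE SPLITTING WITH A FACTOR DEPENDING ONLY ON THE OLD INDEX: `Σ_{s'} F(init s')·G(s') = Σ_s F(s)·Σ_e G(s.snoc e)` — the
shape in which a step-`k` density times a resummed new factor (p. 267's `ζ(Ω_{k+1})`) is summed.
[cite: Balaban1988Convergent, (2.18) p.257, §3 p.267, p.270] -/
theorem sum_seq_succ_init_mul [Finite α] [∀ s : Seq D k, Fintype (ExtPair D k s)] {R : Type*} [Semiring R]
    (F : Seq D k → R) (G : Seq D (k + 1) → R) :
    ∑ s', F s'.init * G s' = ∑ s : Seq D k, F s * ∑ e : ExtPair D k s, G (s.snoc e) := by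
  rw [sum_seq_succ]
  simp only [init_snoc, Finset.mul_sum]

/-- THE SAME SPLITTING OVER THE FIBRES OF `init` (no structure on the pairs needed): `Σ_{s'} f(s') = Σ_s Σ_{s' : init s' = s} f(s')`.
[cite: Balaban1988Convergent, (2.18) p.257, §3 p.267] -/
theorem sum_seq_succ_fiber [Finite α] [DecidableEq (Seq D k)] {M : Type*} [AddCommMonoid M]
    (f : Seq D (k + 1) → M) :
    ∑ s', f s' = ∑ s : Seq D k, ∑ s' ∈ Finset.univ.filter (fun s' : Seq D (k + 1) => s'.init = s), f s' := by
  rw [Finset.sum_fiberwise Finset.univ init f]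

/-- On each fibre of `init`, the pairs parametrise the indices: `Σ_{s' : init s' = s} f(s') = Σ_e f(s.snoc e)`.
[cite: Balaban1988Convergent, (2.18) p.257, §3 p.267, p.270] -/
theorem sum_fiber_eq_sum_extPair [Finite α] [DecidableEq (Seq D k)] (s : Seq D k) [Fintype (ExtPair D k s)]
    {M : Type*} [AddCommMonoid M] (f : Seq D (k + 1) → M) :
    ∑ s' ∈ Finset.univ.filter (fun s' : Seq D (k + 1) => s'.init = s), f s' = ∑ e : ExtPair D k s, f (s.snoc e) := by
  classical
  refine Finset.sum_bij' (fun s' hs' => ⟨((s'.Ω (k + 1), s'.Λ (k + 1)) : Set α × Set α), ?_⟩)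
    (fun e _ => s.snoc e) ?_ ?_ ?_ ?_ ?_
  · -- the last pair of `s'` is admissible after `s = s'.init`
    have hs : s'.init = s := (Finset.mem_filter.1 hs').2
    refine ⟨s'.chain.memΩ (k + 1) (Nat.succ_pos k) le_rfl, s'.chain.memΛ (k + 1) (Nat.succ_pos k) le_rfl,
      s'.chain.Λ_subset (k + 1) (Nat.succ_pos k) le_rfl, fun h1 => ?_⟩
    rw [← hs, init_Λ s' h1 le_rfl]
    exact s'.chain.Ω_succ_subset k h1 (Nat.lt_succ_self k)
  · intro s' hs'; exact Finset.mem_univ _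
  · intro e he; exact Finset.mem_filter.2 ⟨Finset.mem_univ _, init_snoc s e⟩
  · intro s' hs'
    have hs : s'.init = s := (Finset.mem_filter.1 hs').2
    subst hs
    exact snoc_init_extOf s'
  · intro e he
    apply Subtype.ext
    show ((s.snoc e).Ω (k + 1), (s.snoc e).Λ (k + 1)) = e.1
    rw [snoc_Ω_succ, snoc_Λ_succ]
  · intro s' hs'
    have hs : s'.init = s := (Finset.mem_filter.1 hs').2
    subst hs
    show f s' = f (s'.init.snoc s'.extOf)
    rw [snoc_init_extOf]

/-! ## §5  The base `k = 0`: exactly one (empty) admissible sequence -/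

/-- **THE EMPTY SEQUENCE** (`k = 0`: no pair at all; every index `j` is off-window, so both sequences are `∅` throughout).
[cite: Balaban1988Convergent, (2.1) p.254, (2.18) p.257] -/
def zero (D : ℕ → Set (Set α)) : Seq D 0 :=
  ofChain (fun _ => ∅) (fun _ => ∅)
    { memΩ := fun j h1 hj => by omega
      memΛ := fun j h1 hj => by omega
      Λ_subset := fun _ _ _ => le_rfl
      Ω_succ_subset := fun j h1 hj => by omega }

/-- Every admissible sequence of length `0` is the empty one. [cite: Balaban1988Convergent, (2.1) p.254, (2.18) p.257] -/
theorem eq_zero (s : Seq D 0) : s = zero D := by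
  apply ext'
  · funext j; rw [s.Ω_off j (by omega), (zero D).Ω_off j (by omega)]
  · funext j; rw [s.Λ_off j (by omega), (zero D).Λ_off j (by omega)]

/-- The admissible sequences of length `0` form a one-element type (OFFERED as a `def`, not registered).
[cite: Balaban1988Convergent, (2.1) p.254, (2.18) p.257] -/
@[reducible] def uniqueZero (D : ℕ → Set (Set α)) : Unique (Seq D 0) where
  default := zero D
  uniq := eq_zero

/-- **THE BASE OF THE REPRESENTED TOWER**: a sum over admissible sequences of length `0` is its single term at the empty
sequence. [cite: Balaban1988Convergent, (2.18) p.257, (1.28) p.253] -/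
theorem sum_seq_zero [Finite α] {M : Type*} [AddCommMonoid M] (f : Seq D 0 → M) : ∑ s, f s = f (zero D) := by
  have h : (Finset.univ : Finset (Seq D 0)) = {zero D} := by
    ext s
    simp only [Finset.mem_univ, Finset.mem_singleton, true_iff]
    exact eq_zero s
  rw [h, Finset.sum_singleton]

end Seq

end

end Literature.MathematicalPhysics.QuantumFieldTheory.Balaban1983to89.B14.Eq218Concrete
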